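import Literature.Probability.RandomPlanarGeometry.SAWBrickWall
import Literature.Probability.RandomPlanarGeometry.HexSAWLattice
import Literature.Probability.RandomPlanarGeometry.HexSAWTheorem1
import HarnessLib

/-!
# The brick wall is the honeycomb lattice: `x_c(0) = 1/√(2+√2)`

Topic `Literature/Probability/RandomPlanarGeometry`; the `t = 0` anchor of the brick-wall weight
family of `SAWBrickWall.lean` (definition request `defn-SAW.brickWallLaw`, route
`CriticalPhenomena/SAWScalingLimit/SAWBrickWallHomotopy`, item `BrickWallFlow`: "`x_c(0) =
1/μ(honeycomb) = 1/√(2+√2)` since the walks using no odd bond are exactly the brick-wall =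
honeycomb walks").

* `brickWallGraph` — the **brick-wall lattice**: the spanning subgraph of `ℤ²` (`zdGraph 2`)
  without the vertical bonds `{(x, y), (x, y+1)}`, `x + y` odd. Every site keeps its two
  horizontal bonds and exactly one vertical bond.
* `bwIso : brickWallGraph ≃g hvGraph` — the brick wall IS the honeycomb lattice (coordinate
  model `hvGraph ≃g hexGraph` of `HexSAWLattice.lean`): a site `(x, y)` with `x + y` even goes to
  the "up" vertex `((x+y)/2, (y-x)/2)`, one with `x + y` odd to the "down" vertex
  `((x+y-1)/2, (y-x-1)/2)`; the inverse is `(a, b, up) ↦ (a-b, a+b)`, `(a, b, down) ↦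
  (a-b, a+b+1)`; `0 ↦ hvOrigin`.
* `weightedCount_zero_eq_sawCount : Z_n(0) = cₙ(brick wall)` — an `n`-step SAW of `ℤ²` from `0`
  has weight `0^{N_odd} ≠ 0` iff it uses no odd vertical bond iff it is a walk of
  `brickWallGraph` (`SimpleGraph.Walk.transfer` in both directions);
  `weightedCount_zero_eq_hexSawCount : Z_n(0) = cₙ(ℍ)` (transport along `bwIso`, `sawCount_iso`).
* **`criticalFugacityT_zero : x_c(0) = hexCriticalFugacity = 1/√(2+√2)`**, from
  Duminil-Copin–Smirnov's Theorem 1 (`DuminilCopinSmirnov2012_thm1_holds`, proved in the tree):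
  `cₙ(ℍ)^{1/n} → √(2+√2)`, so the `limsup` in `criticalFugacityT 0` is `√(2+√2)`.
  Together with `criticalFugacityT_one : x_c(1) = 1/μ(ℤ²)` this pins both ends of the homotopy.

## References

* H. Duminil-Copin, S. Smirnov, *The connective constant of the honeycomb lattice equals
  `√(2+√2)`*, Ann. of Math. 175 (2012) 1653–1665, Theorem 1.
-/

noncomputable section

open Filter Topology Literature.Probability.LatticeModels Literature.Probability.Percolation
open scoped BigOperators

namespace Literature.Probability.RandomPlanarGeometry.SAW

/-! ### The brick-wall lattice -/

/-- The odd-vertical-bond predicate on an ordered pair of sites: `x`, `y` have the same abscissa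
and `x 0 + min (x 1) (y 1)` is odd (for a vertical bond `{(a, b), (a, b+1)}`: `a + b` odd).
Symmetric in `x`, `y`. This is the predicate counted by `oddVerticalCount`. [folklore] -/
def IsOddVertical (x y : Site 2) : Prop :=
  x 0 = y 0 ∧ (x 0 + min (x 1) (y 1)) % 2 = 1

/-- `IsOddVertical x y` is decidable (a conjunction of integer equalities); with this instance
`if IsOddVertical x y then 1 else 0` is (reducibly) the summand of `oddVerticalCount_cons`.
[folklore] -/
instance IsOddVertical.decidableRel : DecidableRel IsOddVertical := fun _ _ => instDecidableAnd

/-- `IsOddVertical` is symmetric. [folklore] -/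
theorem isOddVertical_comm (x y : Site 2) : IsOddVertical x y ↔ IsOddVertical y x := by
  unfold IsOddVertical
  constructor
  · rintro ⟨h, h'⟩
    refine ⟨h.symm, ?_⟩
    rw [min_comm, ← h]
    exact h'
  · rintro ⟨h, h'⟩
    refine ⟨h.symm, ?_⟩
    rw [min_comm, ← h]
    exact h'

/-- The **brick-wall lattice**: `ℤ²` with the vertical bonds `{(x, y), (x, y+1)}`, `x + y` odd,
deleted — a 3-regular spanning subgraph of `ℤ²` isomorphic to the honeycomb lattice (`bwIso`).
[folklore] -/
def brickWallGraph : SimpleGraph (Site 2) where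
  Adj x y := (zdGraph 2).Adj x y ∧ ¬ IsOddVertical x y
  symm := ⟨fun x y h => ⟨h.1.symm, fun h'' => h.2 ((isOddVertical_comm x y).2 h'')⟩⟩
  loopless := ⟨fun _ h => h.1.ne rfl⟩

/-- Adjacency in the brick wall, unfolded. [folklore] -/
theorem brickWallGraph_adj {x y : Site 2} :
    brickWallGraph.Adj x y ↔ (zdGraph 2).Adj x y ∧ ¬ IsOddVertical x y := Iff.rfl

/-- The brick wall is a spanning subgraph of `ℤ²`. [folklore] -/
theorem brickWallGraph_le : brickWallGraph ≤ zdGraph 2 := fun _ _ h => h.1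

/-- A walk of a graph on `ℤ²` uses no odd vertical bond iff all its darts avoid them. [folklore] -/
theorem oddVerticalCount_eq_zero_iff {G : SimpleGraph (Site 2)} {u v : Site 2} (p : G.Walk u v) :
    oddVerticalCount p = 0 ↔ ∀ d ∈ p.darts, ¬ IsOddVertical d.toProd.1 d.toProd.2 := by
  unfold oddVerticalCount
  rw [List.countP_eq_zero]
  simp only [decide_eq_true_eq, IsOddVertical]

/-- `N_odd` is unchanged by transferring a walk to another graph on `ℤ²` containing its edges
(it only depends on the sequence of sites). [folklore] -/
theorem oddVerticalCount_transfer {G H : SimpleGraph (Site 2)} {u v : Site 2} (p : G.Walk u v)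
    (hp : ∀ e ∈ p.edges, e ∈ H.edgeSet) :
    oddVerticalCount (p.transfer H hp) = oddVerticalCount p := by
  induction p with
  | nil => rfl
  | cons h q ih =>
    simp only [SimpleGraph.Walk.transfer, oddVerticalCount_cons]
    rw [ih]

/-- A walk of the brick wall uses no odd vertical bond. [folklore] -/
theorem oddVerticalCount_eq_zero_of_brickWall {u v : Site 2} (q : brickWallGraph.Walk u v) :
    oddVerticalCount q = 0 := by
  rw [oddVerticalCount_eq_zero_iff]
  intro d _
  exact d.adj.2

/-- Conversely, a walk of `ℤ²` using no odd vertical bond has all its edges in the brick wall.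
[folklore] -/
theorem edges_mem_brickWall_of_oddVerticalCount_eq_zero {u v : Site 2}
    (p : (zdGraph 2).Walk u v) (h : oddVerticalCount p = 0) :
    ∀ e ∈ p.edges, e ∈ brickWallGraph.edgeSet := by
  rw [oddVerticalCount_eq_zero_iff] at h
  intro e he
  rw [SimpleGraph.Walk.edges, List.mem_map] at he
  obtain ⟨d, hd, rfl⟩ := he
  obtain ⟨⟨a, b⟩, hab⟩ := d
  exact ⟨hab, h _ hd⟩

/-! ### Coordinates: the brick wall is the honeycomb lattice -/

/-- Adjacency in the brick wall in coordinates: a horizontal step, or a vertical step along a bond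
`{(a, b), (a, b+1)}` with `a + b` even. (The coordinate form of `zdGraph 2`-adjacency used in
the proof is `zdGraph_two_adj_iff_coord` of `OnsagerYang.lean` / `zdGraph_two_adj_iff` of
`PlanarDuality.lean`, re-derived inline to keep the imports of this file small.) [folklore] -/
theorem brickWallGraph_adj_coord (x y : Site 2) :
    brickWallGraph.Adj x y ↔
      ((y 0 = x 0 + 1 ∨ x 0 = y 0 + 1) ∧ y 1 = x 1) ∨
        (y 0 = x 0 ∧ ((y 1 = x 1 + 1 ∧ (x 0 + x 1) % 2 = 0) ∨
          (x 1 = y 1 + 1 ∧ (y 0 + y 1) % 2 = 0))) := by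
  have hzd : (zdGraph 2).Adj x y ↔
      ((y 0 = x 0 + 1 ∨ x 0 = y 0 + 1) ∧ y 1 = x 1) ∨
        ((y 1 = x 1 + 1 ∨ x 1 = y 1 + 1) ∧ y 0 = x 0) := by
    rw [zdGraph_adj_iff, Fin.exists_fin_two]
    simp only [funext_iff, Fin.forall_fin_two, Pi.add_apply, Pi.single_eq_same,
      Pi.single_eq_of_ne (one_ne_zero : (1 : Fin 2) ≠ 0),
      Pi.single_eq_of_ne (zero_ne_one : (0 : Fin 2) ≠ 1), add_zero]
    omega
  rw [brickWallGraph_adj, hzd, IsOddVertical]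
  constructor
  · rintro ⟨(⟨h0, h1⟩ | ⟨h1 | h1, h0⟩), hn⟩
    · exact Or.inl ⟨h0, h1⟩
    · refine Or.inr ⟨h0, Or.inl ⟨h1, ?_⟩⟩
      rw [h1, min_eq_left (by omega)] at hn
      omega
    · refine Or.inr ⟨h0, Or.inr ⟨h1, ?_⟩⟩
      rw [h1, min_eq_right (by omega)] at hn
      omega
  · rintro (⟨h0, h1⟩ | ⟨h0, (⟨h1, he⟩ | ⟨h1, he⟩)⟩)
    · refine ⟨Or.inl ⟨h0, h1⟩, ?_⟩
      rintro ⟨h, -⟩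
      omega
    · refine ⟨Or.inr ⟨Or.inl h1, h0⟩, ?_⟩
      rintro ⟨-, hn⟩
      rw [h1, min_eq_left (by omega)] at hn
      omega
    · refine ⟨Or.inr ⟨Or.inr h1, h0⟩, ?_⟩
      rintro ⟨-, hn⟩
      rw [h1, min_eq_right (by omega)] at hn
      omega

/-- The brick wall in honeycomb coordinates (`HV = ℤ × ℤ × Bool` of `HexSAWLattice.lean`): a site
with `x + y` even is the up vertex `((x+y)/2, (y-x)/2)`, a site with `x + y` odd the down vertex
`((x+y-1)/2, (y-x-1)/2)`. [folklore] -/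
def bwToHV (x : Site 2) : HV :=
  if (x 0 + x 1) % 2 = 0 then ((x 0 + x 1) / 2, (x 1 - x 0) / 2, false)
  else ((x 0 + x 1 - 1) / 2, (x 1 - x 0 - 1) / 2, true)

/-- The inverse chart: `(a, b, up) ↦ (a - b, a + b)`, `(a, b, down) ↦ (a - b, a + b + 1)`.
[folklore] -/
def hvToBW (v : HV) : Site 2 :=
  ![v.1 - v.2.1, v.1 + v.2.1 + (if v.2.2 then 1 else 0)]

/-- First coordinate of the inverse chart. [folklore] -/
@[simp] theorem hvToBW_apply_zero (v : HV) : hvToBW v 0 = v.1 - v.2.1 := rfl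

/-- Second coordinate of the inverse chart. [folklore] -/
@[simp] theorem hvToBW_apply_one (v : HV) :
    hvToBW v 1 = v.1 + v.2.1 + (if v.2.2 then 1 else 0) := by
  simp [hvToBW]

/-- `hvToBW` is a left inverse of `bwToHV`. [folklore] -/
theorem hvToBW_bwToHV (x : Site 2) : hvToBW (bwToHV x) = x := by
  rw [site_two_eq_iff, hvToBW_apply_zero, hvToBW_apply_one]
  unfold bwToHV
  by_cases h : (x 0 + x 1) % 2 = 0
  · rw [if_pos h]
    simp only [Bool.false_eq_true, ↓reduceIte, add_zero]
    omega
  · rw [if_neg h]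
    simp only [↓reduceIte]
    omega

/-- `bwToHV` is a left inverse of `hvToBW`. [folklore] -/
theorem bwToHV_hvToBW (v : HV) : bwToHV (hvToBW v) = v := by
  obtain ⟨a, b, c⟩ := v
  unfold bwToHV
  rw [hvToBW_apply_zero, hvToBW_apply_one]
  cases c
  · have h : (a - b + (a + b + 0)) % 2 = 0 := by omega
    simp only [Bool.false_eq_true, ↓reduceIte]
    rw [if_pos h]
    exact Prod.ext (by dsimp only; omega) (Prod.ext (by dsimp only; omega) rfl)
  · have h : ¬ (a - b + (a + b + 1)) % 2 = 0 := by omega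
    simp only [↓reduceIte]
    rw [if_neg h]
    exact Prod.ext (by dsimp only; omega) (Prod.ext (by dsimp only; omega) rfl)

/-- The bijection `ℤ² ≃ HV` underlying `bwIso`. [folklore] -/
def bwEquiv : Site 2 ≃ HV where
  toFun := bwToHV
  invFun := hvToBW
  left_inv := hvToBW_bwToHV
  right_inv := bwToHV_hvToBW

/-- The chart sends the origin to the base vertex `hvOrigin`. [folklore] -/
@[simp] theorem bwToHV_zero : bwToHV 0 = hvOrigin := by
  simp [bwToHV, hvOrigin]

/-- The chart is a graph isomorphism: brick-wall adjacency is honeycomb adjacency. [folklore] -/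
theorem brickWallGraph_adj_iff_hvGraph_adj (x y : Site 2) :
    brickWallGraph.Adj x y ↔ hvGraph.Adj (bwToHV x) (bwToHV y) := by
  rw [brickWallGraph_adj_coord, hvGraph_adj, HV.AdjRel]
  unfold bwToHV
  split_ifs with hx hy hy <;> simp <;> omega

/-- **The brick wall is the honeycomb lattice**: `brickWallGraph ≃g hvGraph` (hence
`≃g hexGraph` via `hvIso.symm`). [folklore] -/
def bwIso : brickWallGraph ≃g hvGraph where
  toEquiv := bwEquiv
  map_rel_iff' := fun {x y} => (brickWallGraph_adj_iff_hvGraph_adj x y).symm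

/-- `bwIso` is `bwToHV` on vertices. [folklore] -/
@[simp] theorem bwIso_apply (x : Site 2) : bwIso x = bwToHV x := rfl

/-- The brick wall has as many `n`-step SAWs from `0` as the honeycomb lattice: `cₙ(BW) = cₙ(ℍ)`.
[folklore] -/
theorem sawCount_brickWall (n : ℕ) : sawCount brickWallGraph (0 : Site 2) n = hexSawCount n := by
  rw [hexSawCount_eq_ncard, sawCount_eq_ncard_sawLists, ← bwToHV_zero, ← bwIso_apply,
    ncard_sawLists_iso]

/-! ### `Z_n(0)` counts brick-wall walks -/

/-- An `n`-step walk of `ℤ²` from `0` ends in the box `{-n, …, n}²`. [folklore] -/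
theorem mem_box_of_walk {n : ℕ} {v : Site 2} (p : (zdGraph 2).Walk (0 : Site 2) v)
    (hp : p.length = n) : v ∈ box 2 n := by
  have h := Zd.abs_apply_le_of_adj (ω := p.getVert) (n := n) p.getVert_zero
    (fun i hi => p.adj_getVert_succ (by omega)) n le_rfl
  rw [p.getVert_of_length_le hp.le] at h
  rw [mem_box]
  exact fun j => abs_le.1 (h j)

/-- **`Z_n(0) = cₙ(brick wall)`**: at `t = 0` the weighted count is the number of `n`-step
self-avoiding walks of the brick-wall lattice from `0` (`SAW.sawCount` of `HexSAW.lean`).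
[folklore] -/
theorem weightedCount_zero_eq_sawCount (n : ℕ) :
    weightedCount 0 n = sawCount brickWallGraph (0 : Site 2) n := by
  classical
  -- the zd-side finset of SAWs with no odd vertical bond, fibred over the endpoint
  set T : (v : Site 2) → Finset ((zdGraph 2).Walk (0 : Site 2) v) := fun v =>
    ((((zdGraph 2).finsetWalkLength n (0 : Site 2) v).filter fun p => p.IsPath).filter
      fun p => oddVerticalCount p = 0) with hT
  have hmemT : ∀ {v : Site 2} {p : (zdGraph 2).Walk (0 : Site 2) v},
      p ∈ T v ↔ p.length = n ∧ p.IsPath ∧ oddVerticalCount p = 0 := by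
    intro v p
    simp only [hT, Finset.mem_filter, SimpleGraph.mem_finsetWalkLength_iff, and_assoc]
  have hLHS : weightedCount 0 n = (((box 2 n).sigma T).card : ℝ) := by
    rw [weightedCount_zero, Finset.card_sigma, Nat.cast_sum]
  rw [hLHS, sawCount]
  norm_cast
  symm
  rw [← Set.ncard_coe_finset]
  -- transfer maps in both directions
  have hup : ∀ {v : Site 2} (q : brickWallGraph.Walk (0 : Site 2) v),
      ∀ e ∈ q.edges, e ∈ (zdGraph 2).edgeSet := fun q e he =>
    (SimpleGraph.edgeSet_subset_edgeSet.2 brickWallGraph_le) (q.edges_subset_edgeSet he)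
  refine Set.ncard_congr (fun q _ => ⟨q.1, q.2.transfer (zdGraph 2) (hup q.2)⟩) ?_ ?_ ?_
  · rintro ⟨v, q⟩ ⟨hlen, hpath⟩
    rw [Finset.mem_coe, Finset.mem_sigma]
    have hlen' : (q.transfer (zdGraph 2) (hup q)).length = n := by
      rw [SimpleGraph.Walk.length_transfer]; exact hlen
    refine ⟨mem_box_of_walk _ hlen', hmemT.2 ⟨hlen', ?_, ?_⟩⟩
    · exact hpath.transfer _
    · rw [oddVerticalCount_transfer]; exact oddVerticalCount_eq_zero_of_brickWall q
  · rintro ⟨v, q⟩ ⟨v', q'⟩ _ _ h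
    simp only [Sigma.mk.injEq] at h
    obtain ⟨rfl, h⟩ := h
    have h' := congrArg SimpleGraph.Walk.support (eq_of_heq h)
    simp only [SimpleGraph.Walk.support_transfer] at h'
    cases SimpleGraph.Walk.ext_support h'
    rfl
  · rintro ⟨v, p⟩ hb
    rw [Finset.mem_coe, Finset.mem_sigma] at hb
    obtain ⟨-, hp⟩ := hb
    obtain ⟨hlen, hpath, hodd⟩ := hmemT.1 hp
    refine ⟨⟨v, p.transfer brickWallGraph
      (edges_mem_brickWall_of_oddVerticalCount_eq_zero p hodd)⟩, ⟨?_, hpath.transfer _⟩, ?_⟩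
    · rw [SimpleGraph.Walk.length_transfer, hlen]
    · simp only [Sigma.mk.injEq, heq_eq_eq, true_and]
      rw [SimpleGraph.Walk.transfer_transfer]
      exact p.transfer_self

/-- **`Z_n(0) = cₙ(ℍ)`**: the `n`-step self-avoiding walks of `ℤ²` from `0` using no odd vertical
bond are equinumerous with the `n`-step self-avoiding walks of the hexagonal lattice. [folklore] -/
theorem weightedCount_zero_eq_hexSawCount (n : ℕ) : weightedCount 0 n = hexSawCount n := by
  rw [weightedCount_zero_eq_sawCount, sawCount_brickWall]

/-- **`x_c(0) = 1/√(2+√2)`**, the critical fugacity of the honeycomb lattice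
(`hexCriticalFugacity`): by `weightedCount_zero_eq_hexSawCount` and Duminil-Copin–Smirnov's
Theorem 1 (`DuminilCopinSmirnov2012_thm1_holds`: `cₙ(ℍ)^{1/n} → √(2+√2)`), the `limsup`
defining `criticalFugacityT 0` is the limit `√(2+√2)`. [cite: DuminilCopinSmirnov2012, Thm 1] -/
theorem criticalFugacityT_zero : criticalFugacityT 0 = hexCriticalFugacity := by
  rw [criticalFugacityT, hexCriticalFugacity]
  congr 1
  simp_rw [weightedCount_zero_eq_hexSawCount]
  exact DuminilCopinSmirnov2012_thm1_holds.limsup_eq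

/-- Both ends of the homotopy: `x_c(0) = 1/√(2+√2) = 0.5411…` (honeycomb) and
`x_c(1) = 1/μ(ℤ²)` (square lattice), with `x_c(1) ≤ x_c(t) ≤ x_c(0)` on `[0, 1]`
(`criticalFugacityT_antitoneOn`). [folklore] -/
theorem criticalFugacity_le_criticalFugacityT_le {t : ℝ} (ht0 : 0 ≤ t) (ht1 : t ≤ 1) :
    criticalFugacity ≤ criticalFugacityT t ∧ criticalFugacityT t ≤ hexCriticalFugacity := by
  rw [← criticalFugacityT_one, ← criticalFugacityT_zero]
  exact ⟨criticalFugacityT_antitoneOn ⟨ht0, ht1⟩ ⟨zero_le_one, le_rfl⟩ ht1,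
    criticalFugacityT_antitoneOn ⟨le_rfl, zero_le_one⟩ ⟨ht0, ht1⟩ ht0⟩

end Literature.Probability.RandomPlanarGeometry.SAW
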